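import Summits.Ventures.CertifiedManyBodySolver.Theorems.ThermalStiffnessCeilingU8b8_le_7o44.Negative.CurrentCovarianceTRBlind
import Literature.MathematicalPhysics.QuantumLattice.EnergyEntropyBalance
import HarnessLib

/-!
# Non-vacuity of the current-clustering hypothesis and its load-bearing distance premise
(negative-side helpers for the cruxes K1′ / K1 of route `TcThermcert1`)

Disprover's helpers (`--supports stmt-Ventures-24560`; crux K1′ `TcThermcert1.ThermalStiffnessCeilingU8b8_le_7o44`, line of record
`Cruxes/ThermalStiffnessCeilingU8b8_le_7o44/Lines/gauge_qbp_far_seam.lean` v1.3, bet C8 `stub_currentClustering8`; equally the K1 twin's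
C10): finding F5 of edition 2 of `Cruxes/ThermalStiffnessCeilingU8b8_le_7o44/Disproof.lean`, over the tree's literal operators.

Time-reversal blindness (`CurrentCovarianceTRBlind.lean`, F1) says every time-reversal-EVEN observable has zero covariance with the bond
current `j`. The time-reversal-ODD observable `A = j` does not:

* `re_gibbsCov_self_pos` (generic finite-dimensional fact): for a Hermitian `J` preserving the sector `p` with `ω_p(J) = 0`, the
  covariance `ω_p(J·J) − ω_p(J)² = ω_p(J_pᴴ J_p)` is STRICTLY POSITIVE whenever the block `J_p ≠ 0` — positivity `ω(aᴴa) ≥ 0` plus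
  FAITHFULNESS `Re ω(aᴴa) = 0 ↔ a = 0` of the Gibbs state (`IsHermitian.re_gibbsState_conjTranspose_mul_self_eq_zero_iff`).
* `exists_sector_farBond_apply_ne_zero` / `toBlock_farBond_ne_zero`: the `(N, S^z) = (2M, 0)` sector block of `j_{ab}` is non-zero for
  `a ≠ b`, `1 ≤ M ≤ |Λ| − 1` (move one spin-`0` electron across the bond); `toBlock_farBond_sector7o8_ne_zero`: in particular in the
  line's sector `sectorPred (4q) (1 − 7/8)` (`M = 7q²`) on every torus `L = 4q`. So Hypothesis C constrains a NON-EMPTY class of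
  observables — the bet C8 is not a tautology in disguise.
* `not_currentClusteringBody_7o8_without_distPremise`: the line's `CurrentClustering U (7/8) β ξ` with the premise
  `∀ x ∈ X, d ≤ dist(x, bond)` DELETED (unfolded; checked `Iff.rfl`-equal to the crux work file's `CurrentClusteringWithoutDistPremise`)
  is FALSE for every `U`, `β`, `ξ` (`X` = the bond, `A = j`, `d → ∞`): the distance premise is load-bearing, any proof of C8 must use it.

HONEST FRAMING: finite-dimensional folklore; NO KILL of K1′, of stub B or of the bet C8 is claimed (the refuted statement is a strict
strengthening of Hypothesis C that no registered plan uses), and superconductivity in the Hubbard model is neither proved nor disproved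
by anything in this file.
-/

noncomputable section

open scoped ComplexOrder ComplexConjugate Matrix.Norms.L2Operator
open Filter Topology Matrix Finset
open Literature.MathematicalPhysics.QuantumLattice
open Literature.Probability.LatticeModels
open Summit.Ventures.CertifiedManyBodySolver.Theorems.TcThermcert1.GaugeQbpFarSeam
open Summit.Ventures.CertifiedManyBodySolver.Theorems.TcThermcert1.CurrentCovarianceTRBlind

namespace Summit.Ventures.CertifiedManyBodySolver.Theorems.TcThermcert1.CurrentCovarianceNonVacuity

/-! ## §1 Strict positivity of a self-covariance (generic) -/

section Generic

variable {m : Type*} [Fintype m] [DecidableEq m] (p : m → Prop) [DecidablePred p]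

/-- `Cov_p(J, J) = ω_p(J_pᴴ J_p)` for a Hermitian `J` preserving the sector `p` with `ω_p(J) = 0`
(`(J·J)_p = J_p J_p` by sector preservation). [folklore] -/
theorem gibbsCov_self_eq {H J : Matrix m m ℂ} (β : ℝ) (hJh : J.IsHermitian)
    (hJ : ∀ i j, p i → ¬ p j → J i j = 0 ∧ J j i = 0) (h0 : gibbsState β (H.toBlock p p) (J.toBlock p p) = 0) :
    gibbsState β (H.toBlock p p) ((J * J).toBlock p p)
        - gibbsState β (H.toBlock p p) (J.toBlock p p) * gibbsState β (H.toBlock p p) (J.toBlock p p)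
      = gibbsState β (H.toBlock p p) ((J.toBlock p p)ᴴ * J.toBlock p p) := by
  rw [h0, mul_zero, sub_zero, (isHermitian_toBlock p hJh).eq, toBlock_mul_of_sectorPreserving_left p hJ]

/-- **Strict positivity of the self-covariance**: under the hypotheses of `gibbsCov_self_eq` and `H` Hermitian, `Cov_p(J, J) > 0`
whenever the block `J_p ≠ 0` — positivity and FAITHFULNESS of the Gibbs state, at every `β`. [folklore] -/
theorem re_gibbsCov_self_pos {H J : Matrix m m ℂ} (β : ℝ) (hH : H.IsHermitian) (hJh : J.IsHermitian)
    (hJ : ∀ i j, p i → ¬ p j → J i j = 0 ∧ J j i = 0) (h0 : gibbsState β (H.toBlock p p) (J.toBlock p p) = 0)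
    (hJp : J.toBlock p p ≠ 0) :
    0 < (gibbsState β (H.toBlock p p) ((J * J).toBlock p p)
        - gibbsState β (H.toBlock p p) (J.toBlock p p) * gibbsState β (H.toBlock p p) (J.toBlock p p)).re := by
  rw [gibbsCov_self_eq p β hJh hJ h0]
  have hHp := isHermitian_toBlock p hH
  have h1 := (Complex.le_def.1 (gibbsState_nonneg_of_posSemidef β hHp
    (Matrix.posSemidef_conjTranspose_mul_self (J.toBlock p p)))).1
  rw [Complex.zero_re] at h1
  exact lt_of_le_of_ne h1 fun h => hJp ((hHp.re_gibbsState_conjTranspose_mul_self_eq_zero_iff _ β).1 h.symm)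

end Generic

/-! ## §2 The bond current: sector preservation, sector witness, non-zero sector block -/

section Bond

variable {Λ : Type*} [LinearOrder Λ] [Fintype Λ]

/-- The bond current conserves `(N↑, N↓)`: no entry between an `(N = 2M, S^z = 0)` sector and its complement. [folklore] -/
theorem farBond_sectorPreserving (a b : Λ) (M : ℕ) :
    ∀ s t : Finset (Orb Λ),
      (s.card = 2 * M ∧ 2 * (s.filter fun i => (ofLex i).2 = 0).card = 2 * M) →
      ¬ (t.card = 2 * M ∧ 2 * (t.filter fun i => (ofLex i).2 = 0).card = 2 * M) →
      (∑ σ : Fin 2, ((-Complex.I) • (creation (orb a σ) * annihilation (orb b σ)) +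
          Complex.I • (creation (orb b σ) * annihilation (orb a σ))) :
            Matrix (Finset (Orb Λ)) (Finset (Orb Λ)) ℂ) s t = 0 ∧
      (∑ σ : Fin 2, ((-Complex.I) • (creation (orb a σ) * annihilation (orb b σ)) +
          Complex.I • (creation (orb b σ) * annihilation (orb a σ))) :
            Matrix (Finset (Orb Λ)) (Finset (Orb Λ)) ℂ) t s = 0 :=
  sectorPreserving_of_preservesSectors
    (PreservesSectors.sum fun σ _ =>
      ((LiebThm1.preservesSectors_hopping a b σ).smul _).add ((LiebThm1.preservesSectors_hopping b a σ).smul _)) M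

omit [LinearOrder Λ] [Fintype Λ] in
/-- Orbitals over distinct sites are distinct. [folklore] -/
private theorem orb_ne_of_fst_ne {x y : Λ} (h : x ≠ y) (σ τ : Fin 2) : orb x σ ≠ orb y τ :=
  fun e => h (congrArg (fun k : Orb Λ => (ofLex k).1) e)

omit [LinearOrder Λ] [Fintype Λ] in
/-- Orbitals with distinct spins are distinct. [folklore] -/
private theorem orb_ne_of_snd_ne (x y : Λ) {σ τ : Fin 2} (h : σ ≠ τ) : orb x σ ≠ orb y τ :=
  fun e => h (congrArg (fun k : Orb Λ => (ofLex k).2) e)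

omit [LinearOrder Λ] [Fintype Λ] in
/-- The spin of `orb x σ` is `σ`. [folklore] -/
private theorem snd_orb (x : Λ) (σ : Fin 2) : (ofLex (orb x σ)).2 = σ := rfl

/-- **Sector witness.** For distinct sites `a ≠ b` and `1 ≤ M ≤ |Λ| − 1`, the `(N = 2M, S^z = 0)` coordinate sector contains
configurations `S`, `T` with `⟨T| j_{ab} |S⟩ ≠ 0` (move one spin-`0` electron from `b` to `a`). [folklore] -/
theorem exists_sector_farBond_apply_ne_zero {a b : Λ} (hab : a ≠ b) {M : ℕ} (hM : 1 ≤ M)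
    (hMc : M + 1 ≤ Fintype.card Λ) :
    ∃ S T : Finset (Orb Λ),
      (S.card = 2 * M ∧ 2 * (S.filter fun i => (ofLex i).2 = 0).card = 2 * M) ∧
      (T.card = 2 * M ∧ 2 * (T.filter fun i => (ofLex i).2 = 0).card = 2 * M) ∧
      (∑ σ : Fin 2, ((-Complex.I) • (creation (orb a σ) * annihilation (orb b σ)) +
        Complex.I • (creation (orb b σ) * annihilation (orb a σ))) :
          Matrix (Finset (Orb Λ)) (Finset (Orb Λ)) ℂ) T S ≠ 0 := by
  classical
  have horb_inj : ∀ σ : Fin 2, Function.Injective (fun x : Λ => orb x σ) := fun σ x y h =>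
    congrArg (fun k : Orb Λ => (ofLex k).1) h
  have hcardσ : ∀ σ : Fin 2, (Finset.univ.image (fun x : Λ => orb x σ)).card = Fintype.card Λ := fun σ => by
    rw [Finset.card_image_of_injective _ (horb_inj σ), Finset.card_univ]
  have hmemσ : ∀ σ : Fin 2, ∀ i ∈ Finset.univ.image (fun x : Λ => orb x σ), (ofLex i).2 = σ := by
    intro σ i hi
    obtain ⟨x, -, rfl⟩ := Finset.mem_image.1 hi
    rfl
  have hab0 : orb a 0 ≠ orb b 0 := orb_ne_of_fst_ne hab 0 0
  -- `u₀`: `M` spin-0 orbitals containing `(b,0)` and avoiding `(a,0)`; `u₁`: any `M` spin-1 orbitals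
  have hsub : ({orb b 0} : Finset (Orb Λ)) ⊆ (Finset.univ.image (fun x : Λ => orb x 0)).erase (orb a 0) := by
    rw [Finset.singleton_subset_iff, Finset.mem_erase]
    exact ⟨hab0.symm, Finset.mem_image.2 ⟨b, Finset.mem_univ _, rfl⟩⟩
  have hroom : M ≤ ((Finset.univ.image (fun x : Λ => orb x 0)).erase (orb a 0)).card := by
    rw [Finset.card_erase_of_mem (Finset.mem_image.2 ⟨a, Finset.mem_univ _, rfl⟩), hcardσ 0]
    omega
  obtain ⟨u₀, hbu₀, hu₀, hu₀c⟩ := Finset.exists_subsuperset_card_eq (n := M) hsub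
    (le_of_eq_of_le (Finset.card_singleton _) hM) hroom
  have hroom1 : M ≤ (Finset.univ.image (fun x : Λ => orb x 1)).card := by rw [hcardσ 1]; omega
  obtain ⟨u₁, -, hu₁, hu₁c⟩ := Finset.exists_subsuperset_card_eq (n := M)
    (Finset.empty_subset (Finset.univ.image (fun x : Λ => orb x 1)))
    (le_of_eq_of_le Finset.card_empty (Nat.zero_le M)) hroom1
  have hu₀0 : ∀ i ∈ u₀, (ofLex i).2 = 0 := fun i hi => hmemσ 0 i (Finset.mem_of_mem_erase (hu₀ hi))
  have hu₁1 : ∀ i ∈ u₁, (ofLex i).2 = 1 := fun i hi => hmemσ 1 i (hu₁ hi)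
  have hdisj : Disjoint u₀ u₁ := by
    rw [Finset.disjoint_left]
    intro i hi0 hi1
    have h0 := hu₀0 i hi0
    rw [hu₁1 i hi1] at h0
    exact absurd h0 (by decide)
  have hb0 : orb b 0 ∈ u₀ := hbu₀ (Finset.mem_singleton_self _)
  have ha0 : orb a 0 ∉ u₀ := fun h => (Finset.mem_erase.1 (hu₀ h)).1 rfl
  have ha1 : orb a 0 ∉ u₁ := fun h => by
    have h1 := hu₁1 _ h
    rw [snd_orb] at h1
    exact absurd h1 (by decide)
  -- `S = u₀ ⊔ u₁`
  have hSfilter : ((u₀ ∪ u₁).filter fun i => (ofLex i).2 = 0) = u₀ := by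
    ext i
    simp only [Finset.mem_filter, Finset.mem_union]
    constructor
    · rintro ⟨h | h, h0⟩
      · exact h
      · rw [hu₁1 i h] at h0
        exact absurd h0 (by decide)
    · exact fun h => ⟨Or.inl h, hu₀0 i h⟩
  have hScard : (u₀ ∪ u₁).card = 2 * M := by
    rw [Finset.card_union_of_disjoint hdisj, hu₀c, hu₁c]; ring
  have hbS : orb b 0 ∈ u₀ ∪ u₁ := Finset.mem_union_left _ hb0
  have haS : orb a 0 ∉ u₀ ∪ u₁ := by rw [Finset.mem_union, not_or]; exact ⟨ha0, ha1⟩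
  -- `T = (S ∖ (b,0)) ∪ (a,0)`
  have haSe : orb a 0 ∉ (u₀ ∪ u₁).erase (orb b 0) := fun h => haS (Finset.mem_of_mem_erase h)
  have hTcard : (insert (orb a 0) ((u₀ ∪ u₁).erase (orb b 0))).card = 2 * M := by
    rw [Finset.card_insert_of_notMem haSe, Finset.card_erase_of_mem hbS, hScard]; omega
  have hTfilter : ((insert (orb a 0) ((u₀ ∪ u₁).erase (orb b 0))).filter fun i => (ofLex i).2 = 0) =
      insert (orb a 0) (u₀.erase (orb b 0)) := by
    rw [Finset.filter_insert, if_pos (snd_orb a 0), Finset.filter_erase, hSfilter]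
  refine ⟨u₀ ∪ u₁, insert (orb a 0) ((u₀ ∪ u₁).erase (orb b 0)), ⟨hScard, by rw [hSfilter, hu₀c]⟩,
    ⟨hTcard, ?_⟩, ?_⟩
  · rw [hTfilter, Finset.card_insert_of_notMem (fun h => ha0 (Finset.mem_of_mem_erase h)),
      Finset.card_erase_of_mem hb0, hu₀c]
    omega
  -- the entry `⟨T| j |S⟩ = −i σσ' ≠ 0`
  have hTe : (insert (orb a 0) ((u₀ ∪ u₁).erase (orb b 0))).erase (orb a 0) = (u₀ ∪ u₁).erase (orb b 0) :=
    Finset.erase_insert haSe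
  have haT : orb a 0 ∈ insert (orb a 0) ((u₀ ∪ u₁).erase (orb b 0)) := Finset.mem_insert_self _ _
  have hbT : orb b 0 ∉ insert (orb a 0) ((u₀ ∪ u₁).erase (orb b 0)) := by
    rw [Finset.mem_insert, not_or]
    exact ⟨hab0.symm, Finset.notMem_erase _ _⟩
  have E1 : (creation (orb a 0) * annihilation (orb b 0) : Matrix (Finset (Orb Λ)) (Finset (Orb Λ)) ℂ)
      (insert (orb a 0) ((u₀ ∪ u₁).erase (orb b 0))) (u₀ ∪ u₁) ≠ 0 := by
    rw [LiebThm1.creation_mul_annihilation_apply, if_pos]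
    · exact mul_ne_zero (jwSign_ne_zero _ _) (jwSign_ne_zero _ _)
    · refine ⟨haT, ?_, ?_⟩
      · rw [hTe]; exact Finset.notMem_erase _ _
      · rw [hTe, Finset.insert_erase hbS]
  have E2 : (creation (orb b 0) * annihilation (orb a 0) : Matrix (Finset (Orb Λ)) (Finset (Orb Λ)) ℂ)
      (insert (orb a 0) ((u₀ ∪ u₁).erase (orb b 0))) (u₀ ∪ u₁) = 0 := by
    rw [LiebThm1.creation_mul_annihilation_apply, if_neg]
    exact fun h => hbT h.1
  have E3 : (creation (orb a 1) * annihilation (orb b 1) : Matrix (Finset (Orb Λ)) (Finset (Orb Λ)) ℂ)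
      (insert (orb a 0) ((u₀ ∪ u₁).erase (orb b 0))) (u₀ ∪ u₁) = 0 := by
    rw [LiebThm1.creation_mul_annihilation_apply, if_neg]
    rintro ⟨-, -, hS'⟩
    apply haS
    rw [hS']
    exact Finset.mem_insert_of_mem (Finset.mem_erase.2 ⟨orb_ne_of_snd_ne a a (by decide), haT⟩)
  have E4 : (creation (orb b 1) * annihilation (orb a 1) : Matrix (Finset (Orb Λ)) (Finset (Orb Λ)) ℂ)
      (insert (orb a 0) ((u₀ ∪ u₁).erase (orb b 0))) (u₀ ∪ u₁) = 0 := by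
    rw [LiebThm1.creation_mul_annihilation_apply, if_neg]
    rintro ⟨-, -, hS'⟩
    apply haS
    rw [hS']
    exact Finset.mem_insert_of_mem (Finset.mem_erase.2 ⟨orb_ne_of_snd_ne a b (by decide), haT⟩)
  rw [Matrix.sum_apply, Fin.sum_univ_two]
  simp only [Matrix.add_apply, Matrix.smul_apply, E2, E3, E4, smul_eq_mul, mul_zero, add_zero]
  exact mul_ne_zero (neg_ne_zero.2 Complex.I_ne_zero) E1

/-- **The `(2M, S^z = 0)` sector block of the bond current is non-zero** (`a ≠ b`, `1 ≤ M ≤ |Λ| − 1`). [folklore] -/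
theorem toBlock_farBond_ne_zero {a b : Λ} (hab : a ≠ b) {M : ℕ} (hM : 1 ≤ M) (hMc : M + 1 ≤ Fintype.card Λ) :
    Matrix.toBlock (∑ σ : Fin 2, ((-Complex.I) • (creation (orb a σ) * annihilation (orb b σ)) +
        Complex.I • (creation (orb b σ) * annihilation (orb a σ))) :
          Matrix (Finset (Orb Λ)) (Finset (Orb Λ)) ℂ)
      (fun s => s.card = 2 * M ∧ 2 * (s.filter fun i => (ofLex i).2 = 0).card = 2 * M)
      (fun s => s.card = 2 * M ∧ 2 * (s.filter fun i => (ofLex i).2 = 0).card = 2 * M) ≠ 0 := by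
  obtain ⟨S, T, hS, hT, hne⟩ := exists_sector_farBond_apply_ne_zero hab hM hMc
  intro h0
  apply hne
  have h1 := congrFun (congrFun h0 ⟨T, hT⟩) ⟨S, hS⟩
  rw [Matrix.toBlock_apply, Matrix.zero_apply] at h1
  exact h1

end Bond

/-! ## §3 The bet's density `n = 7/8`: non-zero sector block on `L = 4q`, and the distance premise is load-bearing -/

/-- **The sector block of the current is non-zero at the bet's density** `n = 7/8` on the tori `L = 4q`, `q ≥ 1`
(sector `(N, S^z) = (14q², 0)` = the line's `sectorPred (4q) (1 − 7/8)`; bond `(1,0) ← (0,0)`). [folklore] -/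
theorem toBlock_farBond_sector7o8_ne_zero (q : ℕ) (hq : 1 ≤ q) [NeZero (4 * q)] :
    Matrix.toBlock (∑ σ : Fin 2,
        ((-Complex.I) • (creation (orb (FermionTorus.ofTorusSite (![1, 0] : TorusSite 2 (4 * q))) σ) *
            annihilation (orb (FermionTorus.ofTorusSite (![1 - 1, 0] : TorusSite 2 (4 * q))) σ)) +
          Complex.I • (creation (orb (FermionTorus.ofTorusSite (![1 - 1, 0] : TorusSite 2 (4 * q))) σ) *
            annihilation (orb (FermionTorus.ofTorusSite (![1, 0] : TorusSite 2 (4 * q))) σ))) :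
        Matrix (Finset (Orb (FermionTorus 2 (4 * q)))) (Finset (Orb (FermionTorus 2 (4 * q)))) ℂ)
      (fun s => s.card = 2 * ⌊(1 - (1 - 7 / 8 : ℝ)) * ((4 * q : ℕ) : ℝ) ^ 2 / 2⌋₊ ∧
        2 * (s.filter fun i => (ofLex i).2 = 0).card = 2 * ⌊(1 - (1 - 7 / 8 : ℝ)) * ((4 * q : ℕ) : ℝ) ^ 2 / 2⌋₊)
      (fun s => s.card = 2 * ⌊(1 - (1 - 7 / 8 : ℝ)) * ((4 * q : ℕ) : ℝ) ^ 2 / 2⌋₊ ∧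
        2 * (s.filter fun i => (ofLex i).2 = 0).card = 2 * ⌊(1 - (1 - 7 / 8 : ℝ)) * ((4 * q : ℕ) : ℝ) ^ 2 / 2⌋₊) ≠ 0 := by
  have hM : ⌊(1 - (1 - 7 / 8 : ℝ)) * ((4 * q : ℕ) : ℝ) ^ 2 / 2⌋₊ = 7 * q ^ 2 := by
    have h : (1 - (1 - 7 / 8 : ℝ)) * ((4 * q : ℕ) : ℝ) ^ 2 / 2 = ((7 * q ^ 2 : ℕ) : ℝ) := by push_cast; ring
    rw [h, Nat.floor_natCast]
  have hab : FermionTorus.ofTorusSite (![1, 0] : TorusSite 2 (4 * q)) ≠ FermionTorus.ofTorusSite ![1 - 1, 0] := by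
    intro h
    have h' := congrArg FermionTorus.toTorusSite h
    rw [FermionTorus.toTorusSite_ofTorusSite, FermionTorus.toTorusSite_ofTorusSite] at h'
    have h1 : (![1, 0] : TorusSite 2 (4 * q)) 0 = ![1 - 1, 0] 0 := congrFun h' 0
    simp only [Matrix.cons_val_zero, sub_self] at h1
    haveI : Fact (1 < 4 * q) := ⟨by omega⟩
    exact one_ne_zero h1
  have hcard : Fintype.card (FermionTorus 2 (4 * q)) = (4 * q) ^ 2 := by
    rw [Fintype.card_lex, Fintype.card_fun, Fintype.card_fin, Fintype.card_fin]
  have hq2 : 1 ≤ q ^ 2 := Nat.one_le_pow 2 q hq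
  rw [hM]
  exact toBlock_farBond_ne_zero hab (M := 7 * q ^ 2) (by omega) (by rw [hcard]; nlinarith)

/-- **The distance premise of Hypothesis C is load-bearing.** The line's `CurrentClustering U (7/8) β ξ` with the premise
`∀ x ∈ X, d ≤ dist(x, bond)` DELETED (unfolded below) is FALSE for every `U`, `β`, `ξ`: take `L = 4(L₀+1)`, `X` = the bond's two
sites, `A = j` (even, supported on `X`, sector preserving); the left side is the strictly positive constant `ω_p(j_pᴴ j_p)`
(`re_gibbsCov_self_pos` with `ω_p(j) = 0` from `gibbsState_fluxZeroBlock_farBond_eq_zero`, `toBlock_farBond_sector7o8_ne_zero`), the right side `→ 0` as `d → ∞`. Any proof of the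
bet C8 must use the distance premise. [folklore] -/
theorem not_currentClusteringBody_7o8_without_distPremise (U β ξ : ℝ) :
    ¬ (0 < ξ ∧ ∃ C : ℝ, ∃ k L₀ : ℕ, ∀ (L : ℕ) [NeZero L], L₀ ≤ L →
      ∀ (X : Finset (FermionTorus 2 L)) (A : Matrix (Finset (Orb (FermionTorus 2 L))) (Finset (Orb (FermionTorus 2 L))) ℂ),
        A ∈ carEvenSubalgebra (orbSet X) →
        (∀ s t : Finset (Orb (FermionTorus 2 L)),
          (s.card = 2 * ⌊(1 - (1 - 7 / 8 : ℝ)) * (L : ℝ) ^ 2 / 2⌋₊ ∧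
            2 * (s.filter fun i => (ofLex i).2 = 0).card = 2 * ⌊(1 - (1 - 7 / 8 : ℝ)) * (L : ℝ) ^ 2 / 2⌋₊) →
          ¬ (t.card = 2 * ⌊(1 - (1 - 7 / 8 : ℝ)) * (L : ℝ) ^ 2 / 2⌋₊ ∧
            2 * (t.filter fun i => (ofLex i).2 = 0).card = 2 * ⌊(1 - (1 - 7 / 8 : ℝ)) * (L : ℝ) ^ 2 / 2⌋₊) →
          A s t = 0 ∧ A t s = 0) →
        ∀ (X₀ y : ZMod L) (d : ℕ),
          ‖gibbsState β ((hubbardTorusTT'Flux L 0 U 0).toBlock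
                (fun s => s.card = 2 * ⌊(1 - (1 - 7 / 8 : ℝ)) * (L : ℝ) ^ 2 / 2⌋₊ ∧
                  2 * (s.filter fun i => (ofLex i).2 = 0).card = 2 * ⌊(1 - (1 - 7 / 8 : ℝ)) * (L : ℝ) ^ 2 / 2⌋₊)
                (fun s => s.card = 2 * ⌊(1 - (1 - 7 / 8 : ℝ)) * (L : ℝ) ^ 2 / 2⌋₊ ∧
                  2 * (s.filter fun i => (ofLex i).2 = 0).card = 2 * ⌊(1 - (1 - 7 / 8 : ℝ)) * (L : ℝ) ^ 2 / 2⌋₊))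
              ((A * (∑ σ : Fin 2,
                ((-Complex.I) • (creation (orb (FermionTorus.ofTorusSite (![X₀, y] : TorusSite 2 L)) σ) *
                    annihilation (orb (FermionTorus.ofTorusSite (![X₀ - 1, y] : TorusSite 2 L)) σ)) +
                  Complex.I • (creation (orb (FermionTorus.ofTorusSite (![X₀ - 1, y] : TorusSite 2 L)) σ) *
                    annihilation (orb (FermionTorus.ofTorusSite (![X₀, y] : TorusSite 2 L)) σ))))).toBlock
                (fun s => s.card = 2 * ⌊(1 - (1 - 7 / 8 : ℝ)) * (L : ℝ) ^ 2 / 2⌋₊ ∧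
                  2 * (s.filter fun i => (ofLex i).2 = 0).card = 2 * ⌊(1 - (1 - 7 / 8 : ℝ)) * (L : ℝ) ^ 2 / 2⌋₊)
                (fun s => s.card = 2 * ⌊(1 - (1 - 7 / 8 : ℝ)) * (L : ℝ) ^ 2 / 2⌋₊ ∧
                  2 * (s.filter fun i => (ofLex i).2 = 0).card = 2 * ⌊(1 - (1 - 7 / 8 : ℝ)) * (L : ℝ) ^ 2 / 2⌋₊))
            - gibbsState β ((hubbardTorusTT'Flux L 0 U 0).toBlock
                (fun s => s.card = 2 * ⌊(1 - (1 - 7 / 8 : ℝ)) * (L : ℝ) ^ 2 / 2⌋₊ ∧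
                  2 * (s.filter fun i => (ofLex i).2 = 0).card = 2 * ⌊(1 - (1 - 7 / 8 : ℝ)) * (L : ℝ) ^ 2 / 2⌋₊)
                (fun s => s.card = 2 * ⌊(1 - (1 - 7 / 8 : ℝ)) * (L : ℝ) ^ 2 / 2⌋₊ ∧
                  2 * (s.filter fun i => (ofLex i).2 = 0).card = 2 * ⌊(1 - (1 - 7 / 8 : ℝ)) * (L : ℝ) ^ 2 / 2⌋₊))
              (A.toBlock
                (fun s => s.card = 2 * ⌊(1 - (1 - 7 / 8 : ℝ)) * (L : ℝ) ^ 2 / 2⌋₊ ∧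
                  2 * (s.filter fun i => (ofLex i).2 = 0).card = 2 * ⌊(1 - (1 - 7 / 8 : ℝ)) * (L : ℝ) ^ 2 / 2⌋₊)
                (fun s => s.card = 2 * ⌊(1 - (1 - 7 / 8 : ℝ)) * (L : ℝ) ^ 2 / 2⌋₊ ∧
                  2 * (s.filter fun i => (ofLex i).2 = 0).card = 2 * ⌊(1 - (1 - 7 / 8 : ℝ)) * (L : ℝ) ^ 2 / 2⌋₊))
              * gibbsState β ((hubbardTorusTT'Flux L 0 U 0).toBlock
                (fun s => s.card = 2 * ⌊(1 - (1 - 7 / 8 : ℝ)) * (L : ℝ) ^ 2 / 2⌋₊ ∧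
                  2 * (s.filter fun i => (ofLex i).2 = 0).card = 2 * ⌊(1 - (1 - 7 / 8 : ℝ)) * (L : ℝ) ^ 2 / 2⌋₊)
                (fun s => s.card = 2 * ⌊(1 - (1 - 7 / 8 : ℝ)) * (L : ℝ) ^ 2 / 2⌋₊ ∧
                  2 * (s.filter fun i => (ofLex i).2 = 0).card = 2 * ⌊(1 - (1 - 7 / 8 : ℝ)) * (L : ℝ) ^ 2 / 2⌋₊))
              ((∑ σ : Fin 2,
                ((-Complex.I) • (creation (orb (FermionTorus.ofTorusSite (![X₀, y] : TorusSite 2 L)) σ) *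
                    annihilation (orb (FermionTorus.ofTorusSite (![X₀ - 1, y] : TorusSite 2 L)) σ)) +
                  Complex.I • (creation (orb (FermionTorus.ofTorusSite (![X₀ - 1, y] : TorusSite 2 L)) σ) *
                    annihilation (orb (FermionTorus.ofTorusSite (![X₀, y] : TorusSite 2 L)) σ)))).toBlock
                (fun s => s.card = 2 * ⌊(1 - (1 - 7 / 8 : ℝ)) * (L : ℝ) ^ 2 / 2⌋₊ ∧
                  2 * (s.filter fun i => (ofLex i).2 = 0).card = 2 * ⌊(1 - (1 - 7 / 8 : ℝ)) * (L : ℝ) ^ 2 / 2⌋₊)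
                (fun s => s.card = 2 * ⌊(1 - (1 - 7 / 8 : ℝ)) * (L : ℝ) ^ 2 / 2⌋₊ ∧
                  2 * (s.filter fun i => (ofLex i).2 = 0).card = 2 * ⌊(1 - (1 - 7 / 8 : ℝ)) * (L : ℝ) ^ 2 / 2⌋₊))‖
            ≤ C * ‖A‖ * (X.card : ℝ) ^ k * Real.exp (-(d : ℝ) / ξ)) := by
  rintro ⟨hξ, C, k, L₀, h⟩
  haveI : NeZero (4 * (L₀ + 1)) := ⟨by omega⟩
  have ha : FermionTorus.ofTorusSite ![(1 : ZMod (4 * (L₀ + 1))), 0] ∈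
      ({FermionTorus.ofTorusSite ![(1 : ZMod (4 * (L₀ + 1))), 0], FermionTorus.ofTorusSite ![1 - 1, 0]} :
        Finset (FermionTorus 2 (4 * (L₀ + 1)))) := Finset.mem_insert_self _ _
  have hb : FermionTorus.ofTorusSite ![(1 : ZMod (4 * (L₀ + 1))) - 1, 0] ∈
      ({FermionTorus.ofTorusSite ![(1 : ZMod (4 * (L₀ + 1))), 0], FermionTorus.ofTorusSite ![1 - 1, 0]} :
        Finset (FermionTorus 2 (4 * (L₀ + 1)))) := Finset.mem_insert_of_mem (Finset.mem_singleton_self _)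
  have hJ := farBond_sectorPreserving (FermionTorus.ofTorusSite ![(1 : ZMod (4 * (L₀ + 1))), 0])
    (FermionTorus.ofTorusSite ![(1 : ZMod (4 * (L₀ + 1))) - 1, 0])
    ⌊(1 - (1 - 7 / 8 : ℝ)) * ((4 * (L₀ + 1) : ℕ) : ℝ) ^ 2 / 2⌋₊
  have hj := h (4 * (L₀ + 1)) (by omega) _ _ (farBond_mem_carEvenSubalgebra ha hb) hJ 1 0
  have hpos := lt_of_lt_of_le
    (re_gibbsCov_self_pos _ β (isHermitian_hubbardTorusTT'Flux (4 * (L₀ + 1)) 0 U 0) (isHermitian_farBond _ _) hJ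
      (gibbsState_fluxZeroBlock_farBond_eq_zero (4 * (L₀ + 1)) U β 1 0 _)
      (toBlock_farBond_sector7o8_ne_zero (L₀ + 1) (by omega)))
    (Complex.re_le_norm _)
  set K : ℝ := C * ‖(∑ σ : Fin 2,
        ((-Complex.I) • (creation (orb (FermionTorus.ofTorusSite (![1, 0] : TorusSite 2 (4 * (L₀ + 1)))) σ) *
            annihilation (orb (FermionTorus.ofTorusSite (![1 - 1, 0] : TorusSite 2 (4 * (L₀ + 1)))) σ)) +
          Complex.I • (creation (orb (FermionTorus.ofTorusSite (![1 - 1, 0] : TorusSite 2 (4 * (L₀ + 1)))) σ) *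
            annihilation (orb (FermionTorus.ofTorusSite (![1, 0] : TorusSite 2 (4 * (L₀ + 1)))) σ))) :
        Matrix (Finset (Orb (FermionTorus 2 (4 * (L₀ + 1))))) (Finset (Orb (FermionTorus 2 (4 * (L₀ + 1))))) ℂ)‖ *
    (({FermionTorus.ofTorusSite ![(1 : ZMod (4 * (L₀ + 1))), 0], FermionTorus.ofTorusSite ![1 - 1, 0]} :
        Finset (FermionTorus 2 (4 * (L₀ + 1)))).card : ℝ) ^ k with hK
  have hlim : Tendsto (fun d : ℕ => K * Real.exp (-(d : ℝ) / ξ)) atTop (𝓝 (K * 0)) := by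
    refine tendsto_const_nhds.mul (Real.tendsto_exp_atBot.comp ?_)
    have h1 := tendsto_neg_atTop_atBot.comp ((tendsto_natCast_atTop_atTop (R := ℝ)).atTop_div_const hξ)
    refine h1.congr fun d => ?_
    simp [neg_div]
  rw [mul_zero] at hlim
  obtain ⟨d, hd⟩ := (hlim.eventually (gt_mem_nhds hpos)).exists
  exact lt_irrefl _ ((hj d).trans_lt hd)

end Summit.Ventures.CertifiedManyBodySolver.Theorems.TcThermcert1.CurrentCovarianceNonVacuity

end
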